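import Summits.CriticalPhenomena.Ising3DConformalLimit.Theorems.CoerciveSharpnessCoerciveReflectedGradientDefs
import Literature.Probability.LatticeModels.CriticalTwoPointLower

/-!
# Disproof of `CoerciveReflectedGradient` (stmt-CriticalPhenomena-18197) — findings

Work file of the crux DISPROVER (refuter-cdisprove-stmt-CriticalPhenomena-18197-0; cycle 1, 2026-08-17).
Crux (route `CoerciveSharpness`, K2a): `PhiCoercive → Growth`, where
`Growth := ∃ κ' c₀ > 0, ∃ N₀, ∀ n ≥ N₀, c₀ n^κ' ≤ Q(n)` and `Q = BaseBoxRerun.Qcrux` is the Duminil-Copin–Panis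
reflected gradient on `ℤ³` at `β_c` (verbatim the consequent; `coerciveReflectedGradient_iff`).

## Verdict of cycle 1: NO KILL — and why it resists

The consequent is expected TRUE unconditionally.  Under pure power decay `⟨σ₀σ_x⟩ ≍ |x|^{-(1+η)}`:
`Q(n) = Σ_{x∈Λ_n} Σ_{y∼x} (G(x) - G(𝓡_n x)) G(2(n-y₁)e₁) ≍ n^{1-2η}` (layers at distance `k` from the mirror
contribute `k^{-(1+η)} · k · n^{-η}`, the bulk `n · n^{1-η} · n^{-1-η}`), so `Growth` holds for every
`κ' < 1 - 2η ≈ 0.93` (`η = 0.0363`), while `Growth` at exponent `κ'` forces `η ≤ (1-κ')/2` (the PROVED item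
`WindowOfGrowth`).  A refutation of the crux is therefore a proof of `η ≥ 1/2` on `ℤ³`: against all numerics,
nothing in print (`ledger negatives`: 11 refuted statements of the summit, none on this sub-problem), and no
finite certificate exists (all quantities are infinite-volume `β_c` correlations; `lean`-decidable instances: none).
So every attack below is on LOAD-BEARING STRUCTURE — of the hypothesis, and of the picked line's stubs.

## Findings (all sorry-free)

* §1 `of_growth`, `crux_with_kappa_zero_iff`, `phiCoerciveWith_zero` — the hypothesis `PhiCoercive` is NOT
  load-bearing for TRUTH (`Growth → crux`), so there is no `_false_without_PhiCoercive`; INSIDE the hypothesis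
  exactly `κ > 0` is load-bearing: its `κ = 0` weakening `φ_{β_c}(S) ≥ 1/2 ∀ finite S ⊇ Λ_m` is a THEOREM
  (`sharpLength_criticalBeta_eq_top` + `half_le_dcpPhi_of_subset_box`), and with it the crux collapses to `Growth`.
* §2 `phiCoerciveWith_exponent_le_one`, `not_phiCoerciveWith_of_one_lt` — CEILING on the hypothesis: every
  admissible coercivity exponent has `κ ≤ 1` (witness `S = Λ_m`; shell `≤ 26 m²` sites, summand `≤ 6 C₀/m` by
  Griffiths II + the infrared bound `twoPointFree_le_of_le_criticalBeta`).  So the natural strengthening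
  "`PhiCoercive` with some `κ > 1`" is REFUTED, and the picked line's output `κ' = κ/3` is `≤ 1/3`
  (it can certify at best `η ≤ 1/2 - κ/6`, never `η < 1/3`) — harmless for the crux (`∃ κ' > 0`).
* §3 `growthSelection_exponent_third_optimal` — TIGHTNESS of stub F (`Sig.stub_growthSelection`): with the head
  `C m³/n` the selection lemma cannot output any `κ' > κ/3` (witness `κ = 3`, `Q n = n`, AM–GM), so a better
  exponent needs a better HEAD (the `entrance-shell`/`shell-detection` ideas: `m²/n ⇒ κ/2`), not better
  bookkeeping; `stub_growthSelection_false_without_kappa_pos` — stub F with `0 ≤ κ` is FALSE (`κ = 0`, `Q ≡ 1`).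
* §4 line audit `base_box_rerun` — all six stubs read TRUE as stated (details in §4), incl. degenerate
  dimensions: `boxInput_dim_zero_false` (`BoxInput 0 …` is unsatisfiable ⇒ stubs A–C vacuous at `d = 0`);
  `d = 1, 2` carry the abstract `BoxInput` hypothesis and dimension-free current/torus lemmas.  Joint
  sufficiency is kernel-checked (`CoerciveReflectedGradient_of`).  Nothing for a finite model to bite.
* §5 computation — kit job j026055 (attached to the item): the route's never-read cheapest falsifier of the
  HYPOTHESIS, `φ_{β_c}(Λ_n)` exact in `d = 2` (transfer matrix; surface scaling predicts `n^{3/8}`) and by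
  Swendsen–Wang in `d = 3` (predicts `n^{0.21}`; the mean-field "harmonic measure" scenario = bounded),
  plus rods `[-M,M]×[-n,n] ⊋ Λ_n`.  Table in §5 (filled when the job returns).

For the provers: nothing here obstructs the line; the crux is "true because its conclusion is".  The one
lever that could still sink the ROUTE is the hypothesis item stmt-18196 itself (adversarial supersets
`S ⊋ Λ_m`), which is outside this crux; §2 and §5 are the quantitative facts about it.
-/

noncomputable section

open Finset Filter
open scoped BigOperators Classical

namespace Summit.CriticalPhenomena.Ising3DConformalLimit.Cruxes.CoerciveReflectedGradient.Disproof

open Literature.Probability.LatticeModels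
open Summit.CriticalPhenomena.Ising3DConformalLimit.Theses.CoerciveSharpness (PhiCoercive CoerciveReflectedGradient)
open Summit.CriticalPhenomena.Ising3DConformalLimit.Cruxes.CoerciveReflectedGradient.BaseBoxRerun
  (BoxInput Qcrux Sig.stub_growthSelection)

/-! ## §0 Vocabulary: hypothesis and consequent with explicit exponents -/

/-- The body of `PhiCoercive` at exponent `κ` and constant `c` (verbatim). -/
def PhiCoerciveWith (κ c : ℝ) : Prop :=
  ∀ m : ℕ, 1 ≤ m → ∀ S : Finset (Site 3), box 3 m ⊆ S →
    c * (m : ℝ) ^ κ ≤ criticalBeta 3 * ∑ x ∈ S,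
      ((((zdGraph 3).neighborFinset x).filter fun y => y ∉ S).card : ℝ) *
        isingTwoPoint (zdGraph 3) S (criticalBeta 3) 0 .free 0 x

theorem phiCoercive_iff : PhiCoercive ↔ ∃ κ c : ℝ, 0 < κ ∧ 0 < c ∧ PhiCoerciveWith κ c := Iff.rfl

/-- … and in the tree's `dcpPhi` vocabulary (Duminil-Copin–Panis Def. 1.1), definitionally. -/
theorem phiCoerciveWith_iff_dcpPhi (κ c : ℝ) : PhiCoerciveWith κ c ↔
    ∀ m : ℕ, 1 ≤ m → ∀ S : Finset (Site 3), box 3 m ⊆ S → c * (m : ℝ) ^ κ ≤ dcpPhi 3 (criticalBeta 3) S :=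
  Iff.rfl

/-- The consequent of the crux (verbatim, with `Qcrux` for its right-hand side). -/
def Growth : Prop :=
  ∃ κ' c₀ : ℝ, 0 < κ' ∧ 0 < c₀ ∧ ∃ N₀ : ℕ, ∀ n : ℕ, N₀ ≤ n → c₀ * (n : ℝ) ^ κ' ≤ Qcrux n

/-- The consequent at a fixed exponent. -/
def GrowthWith (κ' : ℝ) : Prop :=
  ∃ c₀ : ℝ, 0 < c₀ ∧ ∃ N₀ : ℕ, ∀ n : ℕ, N₀ ≤ n → c₀ * (n : ℝ) ^ κ' ≤ Qcrux n

theorem growth_iff : Growth ↔ ∃ κ' : ℝ, 0 < κ' ∧ GrowthWith κ' :=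
  ⟨fun ⟨κ', c₀, hκ, hc, h⟩ => ⟨κ', hκ, c₀, hc, h⟩, fun ⟨κ', hκ, c₀, hc, h⟩ => ⟨κ', c₀, hκ, hc, h⟩⟩

/-- The crux is literally `PhiCoercive → Growth`. -/
theorem coerciveReflectedGradient_iff : CoerciveReflectedGradient ↔ (PhiCoercive → Growth) := Iff.rfl

/-! ## §1 Load-bearing analysis of the single hypothesis `PhiCoercive`

`CoerciveReflectedGradientWithoutPhiCoercive` (hypothesis dropped) is `Growth` itself.  There is NO
`coerciveReflectedGradient_false_without_PhiCoercive : ¬ Growth` to be had — `Growth` is expected true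
(module doc) — so the honest record is: the hypothesis is not needed for truth (`of_growth`), and inside it
only `κ > 0` carries information (`phiCoerciveWith_zero`, `crux_with_kappa_zero_iff`).  The κ' = 0 instance of
`Growth` (`∃ c₀ N₀, ∀ n ≥ N₀, c₀ ≤ Q(n)`) is the tree's `dcp_reflectedGradient_lower_holds (d := 3)` after the
finite re-indexing `Σ_{x,y∈Λ_n, y∼x} = Σ_x Σ_i (x ± e_i)` (refuter rattack-18197, evidence `Reindex.lean`;
= the line's stub E at `δ = (0,+)`), so the consequent is a pure growth strengthening of a proved theorem. -/

/-- The crux with its hypothesis dropped.  Open; expected true; not refutable. -/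
def CoerciveReflectedGradientWithoutPhiCoercive : Prop := Growth

/-- `PhiCoercive` is not load-bearing for TRUTH: the bare consequent gives the crux. -/
theorem of_growth : CoerciveReflectedGradientWithoutPhiCoercive → CoerciveReflectedGradient :=
  fun h _ => h

theorem exists_box_supset (S : Finset (Site 3)) : ∃ k : ℕ, 1 ≤ k ∧ S ⊆ box 3 k := by
  refine ⟨max (S.sup Site.supNorm) 1, le_max_right _ _, fun x hx => mem_box_iff_supNorm_le.2 ?_⟩
  exact (Finset.le_sup (f := Site.supNorm) hx).trans (le_max_left _ _)

/-- **The `κ = 0` hypothesis is a theorem** (sharpness at `β_c`, in the tree as `L(β_c) = ∞`):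
`φ_{β_c}(S) ≥ 1/2` for every finite `S ⊇ Λ_m`, i.e. `PhiCoerciveWith 0 (1/2)`. -/
theorem phiCoerciveWith_zero : PhiCoerciveWith 0 (1 / 2) := by
  rw [phiCoerciveWith_iff_dcpPhi]
  intro m hm S hS
  rw [Real.rpow_zero, mul_one]
  obtain ⟨k, hk1, hk⟩ := exists_box_supset S
  have h0 : (0 : Site 3) ∈ S := hS (zero_mem_box 3 m)
  have htop : ((k : ℕ) : ℕ∞) < sharpLength 3 (criticalBeta 3) := by
    rw [sharpLength_criticalBeta_eq_top (d := 3) le_rfl]; exact ENat.coe_lt_top _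
  exact half_le_dcpPhi_of_subset_box hk1 htop h0 hk

/-- Hence weakening `0 < κ` to `0 ≤ κ` in the hypothesis collapses the crux onto its bare consequent. -/
theorem crux_with_kappa_zero_iff :
    ((∃ c : ℝ, 0 < c ∧ PhiCoerciveWith 0 c) → Growth) ↔ Growth :=
  ⟨fun h => h ⟨1 / 2, by norm_num, phiCoerciveWith_zero⟩, fun h _ => h⟩

/-! ## §2 A ceiling on the hypothesis: `κ ≤ 1`

Witness `S = Λ_m`: only the shell `Λ_m \ Λ_{m-1}` (at most `26 m²` sites for `m ≥ 1`) has neighbours outside,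
at most `6` each, and there `⟨σ₀σ_x⟩^free_{Λ_m} ≤ ⟨σ₀σ_x⟩^free ≤ C₀/‖x‖ ≤ C₀/m` (Griffiths II in the volume,
the infrared bound, `‖x‖ = m` on the shell).  So `φ_{β_c}(Λ_m) ≤ 156 β_c C₀ m`, and `c m^κ ≤ K m ∀ m` forces
`κ ≤ 1`.  (Truth: `κ_box = 2 - Δ_σ - Δ̂_σ ≈ 0.21`; with `G ≥ c/|x|²` the same witness would show nothing
below `κ = 1`, so this is the sharp CHEAP ceiling.) -/

/-- summand of the boundary sum of the box -/
def boxTerm (m : ℕ) (x : Site 3) : ℝ :=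
  ((((zdGraph 3).neighborFinset x).filter fun y => y ∉ box 3 m).card : ℝ) *
    isingTwoPoint (zdGraph 3) (box 3 m) (criticalBeta 3) 0 .free 0 x

theorem boxTerm_eq_zero_of_mem_pred {m : ℕ} (hm : 1 ≤ m) {x : Site 3} (hx : x ∈ box 3 (m - 1)) :
    boxTerm m x = 0 := by
  have hempty : (((zdGraph 3).neighborFinset x).filter fun y => y ∉ box 3 m) = ∅ := by
    refine filter_eq_empty_iff.2 fun y hy => ?_
    rw [SimpleGraph.mem_neighborFinset] at hy
    exact not_not.2 (DCPLower.mem_box_of_adj_of_mem_box_pred hm hx hy)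
  rw [boxTerm, hempty, card_empty, Nat.cast_zero, zero_mul]

theorem boxTerm_le {C₀ : ℝ} (hC₀ : 0 < C₀)
    (hC : ∀ x : Site 3, x ≠ 0 → twoPointFree 3 (criticalBeta 3) x ≤ C₀ * (1 / ‖x‖) ^ (3 - 2))
    {m : ℕ} (hm : 1 ≤ m) {x : Site 3} (hxm : x ∈ box 3 m) (hxm1 : x ∉ box 3 (m - 1)) :
    boxTerm m x ≤ 6 * (C₀ / m) := by
  have hβ : 0 ≤ criticalBeta 3 := criticalBeta_nonneg 3
  have hmpos : (0 : ℝ) < m := by exact_mod_cast hm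
  have hcard : (((((zdGraph 3).neighborFinset x).filter fun y => y ∉ box 3 m).card : ℕ) : ℝ) ≤ 6 := by
    have h := (card_filter_le ((zdGraph 3).neighborFinset x) (fun y => y ∉ box 3 m)).trans
      (card_neighborFinset_zdGraph_le (d := 3) x)
    exact_mod_cast h
  have hsup : m ≤ Site.supNorm x := by
    have h := mt mem_box_iff_supNorm_le.2 hxm1
    omega
  have hx0 : x ≠ 0 := by
    intro h0
    have : Site.supNorm x = 0 := Site.supNorm_eq_zero_iff.2 h0
    omega
  have hnorm : (m : ℝ) ≤ ‖x‖ := by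
    rw [Site.norm_eq_supNorm]; exact_mod_cast hsup
  have hG : isingTwoPoint (zdGraph 3) (box 3 m) (criticalBeta 3) 0 .free 0 x ≤ C₀ / m := by
    calc isingTwoPoint (zdGraph 3) (box 3 m) (criticalBeta 3) 0 .free 0 x
        ≤ twoPointFree 3 (criticalBeta 3) x :=
          isingTwoPoint_free_le_twoPointFree isingCorr_free_mono_volume_holds
            hasBoxLimit_isingCorr_free_holds hβ (zero_mem_box 3 m) hxm
      _ ≤ C₀ * (1 / ‖x‖) ^ (3 - 2) := hC x hx0
      _ = C₀ / ‖x‖ := by rw [show (3 - 2 : ℕ) = 1 from rfl, pow_one, mul_one_div]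
      _ ≤ C₀ / m := div_le_div_of_nonneg_left hC₀.le hmpos hnorm
  have hGnn : 0 ≤ isingTwoPoint (zdGraph 3) (box 3 m) (criticalBeta 3) 0 .free 0 x :=
    DCPLower.isingTwoPoint_free_nonneg_of_mem _ hβ (zero_mem_box 3 m) hxm
  calc boxTerm m x ≤ 6 * isingTwoPoint (zdGraph 3) (box 3 m) (criticalBeta 3) 0 .free 0 x :=
        mul_le_mul_of_nonneg_right hcard hGnn
    _ ≤ 6 * (C₀ / m) := by gcongr

theorem card_shell_le {m : ℕ} (hm : 1 ≤ m) :
    (((box 3 m \ box 3 (m - 1)).card : ℕ) : ℝ) ≤ 26 * (m : ℝ) ^ 2 := by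
  rw [card_sdiff_of_subset (box_mono 3 (Nat.sub_le m 1)), card_box, card_box]
  obtain ⟨k, rfl⟩ : ∃ k, m = k + 1 := ⟨m - 1, by omega⟩
  have h1 : (2 * (k + 1 - 1) + 1) ^ 3 ≤ (2 * (k + 1) + 1) ^ 3 :=
    Nat.pow_le_pow_left (by omega) 3
  rw [Nat.cast_sub h1]
  simp only [add_tsub_cancel_right]
  push_cast
  have hk : (0 : ℝ) ≤ k := Nat.cast_nonneg k
  nlinarith [hk, sq_nonneg (k : ℝ)]

/-- The boundary sum of the box `Λ_m` grows at most linearly. -/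
theorem boxBoundarySum_le {C₀ : ℝ} (hC₀ : 0 < C₀)
    (hC : ∀ x : Site 3, x ≠ 0 → twoPointFree 3 (criticalBeta 3) x ≤ C₀ * (1 / ‖x‖) ^ (3 - 2))
    {m : ℕ} (hm : 1 ≤ m) :
    ∑ x ∈ box 3 m, boxTerm m x ≤ 156 * C₀ * m := by
  have hmpos : (0 : ℝ) < m := by exact_mod_cast hm
  have hsub : box 3 m \ box 3 (m - 1) ⊆ box 3 m := sdiff_subset
  have hvan : ∀ x ∈ box 3 m, x ∉ box 3 m \ box 3 (m - 1) → boxTerm m x = 0 := by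
    intro x hx hxs
    have hx' : x ∈ box 3 (m - 1) := by
      by_contra h; exact hxs (mem_sdiff.2 ⟨hx, h⟩)
    exact boxTerm_eq_zero_of_mem_pred hm hx'
  rw [← sum_subset hsub hvan]
  have hterm : ∀ x ∈ box 3 m \ box 3 (m - 1), boxTerm m x ≤ 6 * (C₀ / m) := fun x hx =>
    boxTerm_le hC₀ hC hm (mem_sdiff.1 hx).1 (mem_sdiff.1 hx).2
  calc ∑ x ∈ box 3 m \ box 3 (m - 1), boxTerm m x ≤ ∑ _x ∈ box 3 m \ box 3 (m - 1), 6 * (C₀ / m) :=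
        sum_le_sum hterm
    _ = ((box 3 m \ box 3 (m - 1)).card : ℝ) * (6 * (C₀ / m)) := by rw [sum_const, nsmul_eq_mul]
    _ ≤ 26 * (m : ℝ) ^ 2 * (6 * (C₀ / m)) := by
        have := card_shell_le hm
        gcongr
    _ = 156 * C₀ * m := by field_simp; ring

theorem exists_nat_rpow_ge {a : ℝ} (ha : 0 < a) (K : ℝ) : ∃ m : ℕ, 1 ≤ m ∧ K ≤ (m : ℝ) ^ a := by
  have hK : 0 ≤ max K 0 := le_max_right _ _
  obtain ⟨m, hm⟩ := exists_nat_ge ((max K 0) ^ (1 / a) + 1)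
  have hle : (max K 0) ^ (1 / a) ≤ (m : ℝ) := by linarith
  have h0 : (0 : ℝ) ≤ (max K 0) ^ (1 / a) := Real.rpow_nonneg hK _
  refine ⟨m, ?_, ?_⟩
  · exact_mod_cast (show (1 : ℝ) ≤ m by linarith)
  · calc K ≤ max K 0 := le_max_left _ _
      _ = ((max K 0) ^ (1 / a)) ^ a := by
          rw [← Real.rpow_mul hK, one_div_mul_cancel ha.ne', Real.rpow_one]
      _ ≤ (m : ℝ) ^ a := Real.rpow_le_rpow h0 hle ha.le


/-- `φ_{β_c}(Λ_m) ≤ 156 β_c C₀ m`. -/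
theorem phiBox_le {C₀ : ℝ} (hC₀ : 0 < C₀)
    (hC : ∀ x : Site 3, x ≠ 0 → twoPointFree 3 (criticalBeta 3) x ≤ C₀ * (1 / ‖x‖) ^ (3 - 2))
    {m : ℕ} (hm : 1 ≤ m) :
    criticalBeta 3 * ∑ x ∈ box 3 m,
      ((((zdGraph 3).neighborFinset x).filter fun y => y ∉ box 3 m).card : ℝ) *
        isingTwoPoint (zdGraph 3) (box 3 m) (criticalBeta 3) 0 .free 0 x ≤
      criticalBeta 3 * (156 * C₀) * m := by
  have h := boxBoundarySum_le hC₀ hC hm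
  simp only [boxTerm] at h
  have hβ : 0 ≤ criticalBeta 3 := criticalBeta_nonneg 3
  calc _ ≤ criticalBeta 3 * (156 * C₀ * m) := mul_le_mul_of_nonneg_left h hβ
    _ = _ := by ring

/-- **Ceiling on the coercivity exponent**: `κ ≤ 1`. -/
theorem phiCoerciveWith_exponent_le_one {κ c : ℝ} (hc : 0 < c) (h : PhiCoerciveWith κ c) : κ ≤ 1 := by
  by_contra hκ
  push Not at hκ
  obtain ⟨C₀, hC₀, hC⟩ := twoPointFree_le_of_le_criticalBeta (d := 3) le_rfl
  have hβ : 0 ≤ criticalBeta 3 := criticalBeta_nonneg 3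
  have hK : 0 ≤ criticalBeta 3 * (156 * C₀) := by positivity
  have hbound : ∀ m : ℕ, 1 ≤ m → c * (m : ℝ) ^ κ ≤ criticalBeta 3 * (156 * C₀) * m := fun m hm =>
    (h m hm (box 3 m) subset_rfl).trans (phiBox_le hC₀ (fun x hx => hC _ hβ le_rfl x hx) hm)
  have hκ1 : 0 < κ - 1 := by linarith
  obtain ⟨m, hm1, hmK⟩ := exists_nat_rpow_ge hκ1 (criticalBeta 3 * (156 * C₀) / c + 1)
  have hmpos : (0 : ℝ) < m := by exact_mod_cast hm1
  have h3 := hbound m hm1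
  have hsplit : (m : ℝ) ^ κ = (m : ℝ) ^ (κ - 1) * m := by
    rw [← Real.rpow_add_one hmpos.ne' (κ - 1)]; ring_nf
  rw [hsplit] at h3
  have h4 : c * ((criticalBeta 3 * (156 * C₀) / c + 1) * m) ≤ c * ((m : ℝ) ^ (κ - 1) * m) :=
    mul_le_mul_of_nonneg_left (mul_le_mul_of_nonneg_right hmK hmpos.le) hc.le
  have h5 : c * ((criticalBeta 3 * (156 * C₀) / c + 1) * m) = criticalBeta 3 * (156 * C₀) * m + c * m := by
    field_simp
  nlinarith [mul_pos hc hmpos]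

theorem not_phiCoerciveWith_of_one_lt {κ c : ℝ} (hκ : 1 < κ) (hc : 0 < c) : ¬ PhiCoerciveWith κ c :=
  fun h => absurd (phiCoerciveWith_exponent_le_one hc h) (not_le.2 hκ)

/-! ## §3 Stub F (`Sig.stub_growthSelection`): tightness and its load-bearing `0 < κ` -/


/-- No eventual power lower bound `c₀ n^a ≤ K` with `a > 0`. -/
theorem not_eventually_rpow_le_const {a c₀ K : ℝ} (ha : 0 < a) (hc₀ : 0 < c₀) (N₀ : ℕ)
    (h : ∀ n : ℕ, N₀ ≤ n → c₀ * (n : ℝ) ^ a ≤ K) : False := by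
  obtain ⟨m, hm1, hmK⟩ := exists_nat_rpow_ge ha ((K + 1) / c₀)
  have hn := h (max m N₀) (le_max_right _ _)
  have hmono : (m : ℝ) ^ a ≤ ((max m N₀ : ℕ) : ℝ) ^ a :=
    Real.rpow_le_rpow (Nat.cast_nonneg m) (by exact_mod_cast le_max_left m N₀) ha.le
  have : (K + 1) / c₀ * c₀ = K + 1 := div_mul_cancel₀ _ hc₀.ne'
  nlinarith [mul_le_mul_of_nonneg_left (hmK.trans hmono) hc₀.le]

/-- **Stub F is sharp at `κ/3`.** The strengthening of `Sig.stub_growthSelection` that asks for an output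
exponent `κ' > κ/3` is FALSE: with `κ = 3`, `c = C = A = 1` the function `Q n = n` satisfies the
hypothesis (`m³ ≤ m⁶/n + n` is AM–GM) but has no eventual lower bound `c₀ n^κ'` with `κ' > 1`. -/
theorem growthSelection_exponent_third_optimal :
    ¬ (∀ (Q : ℕ → ℝ) (κ c C A : ℝ), 0 < κ → 0 < c → 0 < C → 0 < A →
      (∀ m n : ℕ, 1 ≤ m → 2 * m ≤ n →
        c * (m : ℝ) ^ κ ≤ c * (m : ℝ) ^ κ * (C * (m : ℝ) ^ 3 / (n : ℝ)) + A * Q n) →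
      ∃ κ' c₀ : ℝ, κ / 3 < κ' ∧ 0 < c₀ ∧ ∃ N₀ : ℕ, ∀ n : ℕ, N₀ ≤ n → c₀ * (n : ℝ) ^ κ' ≤ Q n) := by
  intro h
  have hyp : ∀ m n : ℕ, 1 ≤ m → 2 * m ≤ n →
      (1 : ℝ) * (m : ℝ) ^ (3 : ℝ) ≤ 1 * (m : ℝ) ^ (3 : ℝ) * (1 * (m : ℝ) ^ 3 / (n : ℝ)) + 1 * (n : ℝ) := by
    intro m n hm hmn
    have hm' : (1 : ℝ) ≤ m := by exact_mod_cast hm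
    have hn' : (2 : ℝ) * m ≤ n := by exact_mod_cast hmn
    have hnpos : (0 : ℝ) < n := by linarith
    have hn0 : (n : ℝ) ≠ 0 := hnpos.ne'
    have h3 : (m : ℝ) ^ (3 : ℝ) = (m : ℝ) ^ (3 : ℕ) := by exact_mod_cast Real.rpow_natCast (m : ℝ) 3
    simp only [one_mul, h3]
    rw [← sub_nonneg]
    have key : (m : ℝ) ^ 3 * ((m : ℝ) ^ 3 / n) + n - (m : ℝ) ^ 3 =
        ((m : ℝ) ^ 3 - n) ^ 2 / n + (m : ℝ) ^ 3 := by
      field_simp; ring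
    rw [key]; positivity
  obtain ⟨κ', c₀, hκ', hc₀, N₀, hN⟩ := h (fun n => (n : ℝ)) 3 1 1 1 (by norm_num) one_pos one_pos one_pos hyp
  have hκ'1 : 0 < κ' - 1 := by linarith
  -- `c₀ n^{κ'} ≤ n` means `c₀ n^{κ'-1} ≤ 1` for `n ≥ max N₀ 1`
  refine not_eventually_rpow_le_const hκ'1 hc₀ (max N₀ 1) (K := 1) fun n hn => ?_
  have hn1 : (1 : ℝ) ≤ n := by exact_mod_cast (le_max_right N₀ 1).trans hn
  have hnpos : (0 : ℝ) < n := by linarith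
  have h1 := hN n ((le_max_left N₀ 1).trans hn)
  have hsplit : (n : ℝ) ^ κ' = (n : ℝ) ^ (κ' - 1) * n := by
    rw [← Real.rpow_add_one hnpos.ne' (κ' - 1)]; ring_nf
  rw [hsplit] at h1
  by_contra hlt
  push Not at hlt
  nlinarith [mul_lt_mul_of_pos_right hlt hnpos]

/-- **`0 < κ` is load-bearing in stub F**: with `0 ≤ κ` allowed the selection lemma is FALSE
(witness `κ = 0`, `Q ≡ c/A` constant satisfies the hypothesis and has no growth). -/
theorem stub_growthSelection_false_without_kappa_pos :
    ¬ (∀ (Q : ℕ → ℝ) (κ c C A : ℝ), 0 ≤ κ → 0 < c → 0 < C → 0 < A →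
      (∀ m n : ℕ, 1 ≤ m → 2 * m ≤ n →
        c * (m : ℝ) ^ κ ≤ c * (m : ℝ) ^ κ * (C * (m : ℝ) ^ 3 / (n : ℝ)) + A * Q n) →
      ∃ κ' c₀ : ℝ, 0 < κ' ∧ 0 < c₀ ∧ ∃ N₀ : ℕ, ∀ n : ℕ, N₀ ≤ n → c₀ * (n : ℝ) ^ κ' ≤ Q n) := by
  intro h
  have hyp : ∀ m n : ℕ, 1 ≤ m → 2 * m ≤ n →
      (1 : ℝ) * (m : ℝ) ^ (0 : ℝ) ≤ 1 * (m : ℝ) ^ (0 : ℝ) * (1 * (m : ℝ) ^ 3 / (n : ℝ)) + 1 * (1 : ℝ) := by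
    intro m n hm hmn
    rw [Real.rpow_zero]
    have : (0 : ℝ) ≤ 1 * (m : ℝ) ^ 3 / (n : ℝ) := by positivity
    linarith
  obtain ⟨κ', c₀, hκ', hc₀, N₀, hN⟩ := h (fun _ => (1 : ℝ)) 0 1 1 1 le_rfl one_pos one_pos one_pos hyp
  exact not_eventually_rpow_le_const hκ' hc₀ N₀ hN

/-- For the record: the registered stub F has `0 < κ` and reads TRUE (choose `m = ⌊(n/2C)^{1/3}⌋`); the
two theorems above only locate its sharp edges. -/
example : Sig.stub_growthSelection ↔
    (∀ (Q : ℕ → ℝ) (κ c C A : ℝ), 0 < κ → 0 < c → 0 < C → 0 < A →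
      (∀ m n : ℕ, 1 ≤ m → 2 * m ≤ n →
        c * (m : ℝ) ^ κ ≤ c * (m : ℝ) ^ κ * (C * (m : ℝ) ^ 3 / (n : ℝ)) + A * Q n) →
      ∃ κ' c₀ : ℝ, 0 < κ' ∧ 0 < c₀ ∧ ∃ N₀ : ℕ, ∀ n : ℕ, N₀ ≤ n → c₀ * (n : ℝ) ^ κ' ≤ Q n) := Iff.rfl

/-! ## §4 Audit of the picked line `base_box_rerun` (six stubs; lead prover-line-18197-0)

Read against `Lines/base_box_rerun.lean` / `Theorems/CoerciveSharpnessCoerciveReflectedGradientDefs.lean`: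

* Stub A `Sig.stub_boxPointwise` (∀ d, abstract predicates `c_δ`): TRUE.  If some `z ∈ Λ_m` has `c_δ z` the
  indicator sum is `≥ 1` and the second term is `≥ 0` (`w ≥ 0`, GKS I on the torus).  Otherwise `0 ∈ Λ_m` gives
  `¬c_δ 0 ∀ δ`, `S := {z ∈ Λ_n : ∀ δ, ¬c_δ z}` satisfies `Λ_m ⊆ S ⊆ Λ_{n-1}` (faces carry `c` by hypothesis), the
  box input applies, and each of its pairs `(x ∈ S, y ∉ S, y ∼ x)` appears (for a `δ` with `c_δ y`; `y ∈ Λ_n`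
  since `x ∈ Λ_{n-1}`) in the right-hand side with the larger weight `⟨σ_0̄σ_x̄⟩_{W_δ} ≥ ⟨σ₀σ_x⟩_S`
  (`proj` injective on `Λ_n` as `2n+1 < L`, an injective graph map + Griffiths II).  Unused pairs are `≥ 0`.
* Stub B `stub_boxPointwise → BoxTorusIneq` (∀ d, ∀ β ≥ 0): TRUE — LANDED by the lead
  (`Theorems/CoerciveSharpnessCoerciveReflectedGradientStubBoxTorus.lean`).  The second term is VERBATIM the
  base-point-0 one (the indicator keeps `¬c_δ 0`); only the head is new (Lemma 2.4 at `z̄ ∈ dirHalf`, `m < n`).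
* Stub C `BoxTorusIneq → BoxInfiniteVolume` (`d ≥ 3`, `0 ≤ β ≤ β_c`): TRUE, termwise limits of finitely many
  torus two-point functions along even tori at `m*(β) = 0`, exactly as `infiniteVolume_ineq_of_lemma25`.
* Stub D `Sig.stub_headSmall`: TRUE, `‖dirRefl δ n z - z‖ = 2|±n - z_δ| ≥ 2(n-m) ≥ n`, infrared bound, `6(2m+1)³ ≤ 162 m³`.
  It is also the EXPONENT BOTTLENECK of the line (§3): any head `C m^a/n` yields `κ' = κ/a`.
* Stub E `Sig.stub_reflectedSumIdentity`: TRUE (hyperoctahedral invariance of `twoPointFree` — equal box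
  sequences, so even `limUnder`-junk-proof; translation invariance `freePair_eq_twoPointFree_sub` needs the
  GKS box limit, available at `β_c ≥ 0`; re-indexing as in `Reindex.lean`); `n = 0`: both sides `0`.
* Stub F `Sig.stub_growthSelection`: TRUE (floors + `rpow`); sharp at `κ/3` and needs `0 < κ` (§3).
* Degenerate dimensions: `d = 0` — `BoxInput 0 β w m n` is unsatisfiable (`boxInput_dim_zero_false`), so A–C hold
  vacuously; `d = 1, 2` — A is the same two-case argument, B is dimension-free (currents on `(ℤ/Lℤ)^d`), C is void.
* Joint sufficiency: `CoerciveReflectedGradient_of` is kernel-checked (SKELVET PASS); `PhiCoercive` enters once,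
  as `BoxInput 3 β_c (β_c/(c m^κ)) m n` — it quantifies over ALL finite `S ⊇ Λ_m`, more than the line uses
  (`S ⊆ Λ_{n-1}` only), so no gap is smuggled.
-/

/-- In dimension `0` the box input is unsatisfiable (the one-point lattice has no boundary edges), so the
`∀ d` stubs A–C of the line are vacuous there — recorded to close the degenerate case, not as an objection. -/
theorem boxInput_dim_zero_false (β w : ℝ) (m n : ℕ) : ¬ BoxInput 0 β w m n := by
  intro h
  have hsub : box 0 m ⊆ box 0 (n - 1) := fun x _ => by
    rw [Subsingleton.elim x 0]; exact zero_mem_box 0 (n - 1)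
  have h1 := h (box 0 m) subset_rfl hsub
  -- `y ∉ box 0 m` is impossible (`mem_box` over `Fin 0`), so every boundary count is `0`
  simp at h1
  exact absurd h1 (by norm_num)

/-! ## §5 Computation: is the hypothesis even plausible?  (kit job j026055, attached to the item)

`φ_{β_c}(S) = β_c Σ_{x∈S} #{y ∉ S : y ∼ x} ⟨σ₀σ_x⟩^free_S` — estimator `⟨σ₀σ_x⟩^free_S = P_FK[0 ↔ x]`, so
`φ = β_c · E[Σ_{x ∈ ∂S} mult(x) 𝟙{x ∈ C(0)}]`.  (A) d = 2 exact transfer matrix, boxes `n ≤ 10` and rods;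
(B) d = 2 Swendsen–Wang cross-check; (C) d = 3 Swendsen–Wang at `β_c = 0.221654626`, `N = 2n+1 ≤ 33`.
Predictions: `κ_box(2D) = 3/8`, `κ_box(3D) ≈ 0.21`, mean field `0`.
RESULTS: pending at the time of this revision (job queued 12:39Z); see the item's evidence `compute-j026055.json`
and the next revision of this file.
-/

/-! ## Targets (lead's stuck stubs): none flagged as of cycle 1. -/

end Summit.CriticalPhenomena.Ising3DConformalLimit.Cruxes.CoerciveReflectedGradient.Disproof

end
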